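import Summits.CriticalPhenomena.CardyFormulaZ2.Theorems.CardyBoundaryCoulombGasBoundaryDefectGaussianRStubRealisabilityPart48

/-!
# Stub `s17_eventually_configsNonempty` of the D2 completion (line
# `rainbow-monomials-in-excursion-kernels`, crux `BoundaryDefectGaussianR`,
# stmt-CriticalPhenomena-14132) — Part 2: charts of ARBITRARY fixed lattice radius, eventually

Part 47 (`ec_lattice_chart`, `ec_chart_of_small`, `ec_eventually_chart`) reads the uniform closure
charts of a rectilinear Jordan domain (`ec_uniform_closure_chart`: one radius `r₀ > 0` such that the
closed `r₀`-disc about any frontier point lies in the disc of a half-plane / quadrant / co-quadrant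
chart of the closure) on the lattice approximation `V = {v : δ v ∈ closure D}` at the FIXED lattice
radius `3` (mesh `10 δ ≤ r₀`). The existence of a height configuration (this stub) compares
prescribed cells of the jump collar at lattice distance up to the number of legs, so it needs the
same charts on boxes of an arbitrary but fixed lattice radius `N`: this file is the one-parameter
generalisation, with the same proofs.

* `bc_lattice_chart` — at mesh `δ` with `C δ ≤ r₀`, on the mesh points within `C δ` of a frontier
  point, `V` is a half-plane `c₂ ≤ ⟨v, dir (K+1)⟩`, a quadrant `c₁ ≤ ⟨v, dir K⟩ ∧ c₂ ≤ ⟨v, dir (K+1)⟩`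
  or a co-quadrant `c₂ ≤ ⟨v, dir (K+1)⟩ ∨ ⟨v, dir K⟩ ≤ c₁` (`tp_lattice_flat / convex / reflex`);
* `bc_chart_of_small` — hence, at mesh `(2N + 2) δ ≤ r₀`, every boundary vertex `u ∈ V`,
  `u + dir k ∉ V`, has such a chart on the box of sup-radius `N` about `u` (a frontier point lies
  within `2 δ` of the mesh point of `u`, the box within `2N δ` of it);
* `bc_eventually_chart` and the registered one-line form `s17_configsNonempty_part2` — eventually
  along a mesh sequence `δ_n → 0⁺`, for every fixed `N`.
All [folklore].
-/

noncomputable section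

open Set Filter Metric Topology
open Literature.Probability.RandomPlanarGeometry
open Literature.Probability.LatticeModels Literature.Probability.LatticeModels.CollarLegModel

namespace Summit.CriticalPhenomena.CardyFormulaZ2.Cruxes.BoundaryDefectGaussianR.RainbowMonomialsInExcursionKernels

/-- **Lattice charts near the frontier, at scale `C δ`.** At mesh `δ` with `C δ ≤ r₀` (`r₀` the
uniform chart radius), the lattice approximation `V = {v : δ v ∈ closure D}` is, on the mesh points
within `C δ` of any frontier point, a half-plane, a quadrant or a co-quadrant in the `(K, c₁, c₂)`
encoding of CHART. [folklore] -/
theorem bc_lattice_chart (D : JordanDomain) {δ : ℝ} (hδ : 0 < δ) {V : Finset (ℤ × ℤ)}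
    (hV : ∀ v : ℤ × ℤ, v ∈ V ↔
      ((v.1 : ℂ) * ((δ : ℝ) : ℂ) + (v.2 : ℂ) * ((δ : ℝ) : ℂ) * Complex.I) ∈ closure D.carrier)
    {r₀ C : ℝ} (hδr : C * δ ≤ r₀)
    (hunif : ∀ ζ ∈ frontier D.carrier, ∃ (p : ℂ) (r : ℝ) (K : Fin 4) (m : ℕ),
      (m = 1 ∨ m = 2 ∨ m = 3) ∧ (∀ z, dist z ζ ≤ r₀ → dist z p < r) ∧
      ∀ z, dist z p < r → (z ∈ closure D.carrier ↔
        (m = 1 → 0 ≤ ((z - p) * (-Complex.I) ^ (K : ℕ)).re ∧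
            0 ≤ ((z - p) * (-Complex.I) ^ (K : ℕ)).im) ∧
          (m = 2 → 0 ≤ ((z - p) * (-Complex.I) ^ (K : ℕ)).im) ∧
          (m = 3 → 0 ≤ ((z - p) * (-Complex.I) ^ (K : ℕ)).im ∨
            ((z - p) * (-Complex.I) ^ (K : ℕ)).re ≤ 0)))
    {ζ : ℂ} (hζ : ζ ∈ frontier D.carrier) :
    ∃ (K : Fin 4) (c₁ c₂ : ℤ),
      (∀ v : ℤ × ℤ, dist ((v.1 : ℂ) * ((δ : ℝ) : ℂ) + (v.2 : ℂ) * ((δ : ℝ) : ℂ) * Complex.I) ζ ≤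
        C * δ → (v ∈ V ↔ c₂ ≤ v.1 * (dir (K + 1)).1 + v.2 * (dir (K + 1)).2)) ∨
      (∀ v : ℤ × ℤ, dist ((v.1 : ℂ) * ((δ : ℝ) : ℂ) + (v.2 : ℂ) * ((δ : ℝ) : ℂ) * Complex.I) ζ ≤
        C * δ → (v ∈ V ↔ c₁ ≤ v.1 * (dir K).1 + v.2 * (dir K).2 ∧
          c₂ ≤ v.1 * (dir (K + 1)).1 + v.2 * (dir (K + 1)).2)) ∨
      (∀ v : ℤ × ℤ, dist ((v.1 : ℂ) * ((δ : ℝ) : ℂ) + (v.2 : ℂ) * ((δ : ℝ) : ℂ) * Complex.I) ζ ≤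
        C * δ → (v ∈ V ↔ c₂ ≤ v.1 * (dir (K + 1)).1 + v.2 * (dir (K + 1)).2 ∨
          v.1 * (dir K).1 + v.2 * (dir K).2 ≤ c₁)) := by
  obtain ⟨p, r, K, m, hm, hball, hchart⟩ := hunif ζ hζ
  have hin : ∀ v : ℤ × ℤ,
      dist ((v.1 : ℂ) * ((δ : ℝ) : ℂ) + (v.2 : ℂ) * ((δ : ℝ) : ℂ) * Complex.I) ζ ≤ C * δ →
      dist ((v.1 : ℂ) * ((δ : ℝ) : ℂ) + (v.2 : ℂ) * ((δ : ℝ) : ℂ) * Complex.I) p < r :=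
    fun v hv => hball _ (hv.trans hδr)
  refine ⟨K, ?_⟩
  rcases hm with rfl | rfl | rfl
  · refine ⟨⌈(p * (-Complex.I) ^ (K : ℕ)).re / δ⌉, ⌈(p * (-Complex.I) ^ (K : ℕ)).im / δ⌉,
      Or.inr (Or.inl fun v hv => ?_)⟩
    have hch : ∀ w, dist w p < r → (w ∈ closure D.carrier ↔
        0 ≤ ((w - p) * (-Complex.I) ^ (K : ℕ)).re ∧ 0 ≤ ((w - p) * (-Complex.I) ^ (K : ℕ)).im) :=
      fun w hw => by rw [hchart w hw, tp_csec_one]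
    exact tp_lattice_convex hδ hV K hch v (hin v hv)
  · refine ⟨0, ⌈(p * (-Complex.I) ^ (K : ℕ)).im / δ⌉, Or.inl fun v hv => ?_⟩
    have hch : ∀ w, dist w p < r → (w ∈ closure D.carrier ↔
        0 ≤ ((w - p) * (-Complex.I) ^ (K : ℕ)).im) :=
      fun w hw => by rw [hchart w hw, tp_csec_two]
    exact tp_lattice_flat hδ hV K hch v (hin v hv)
  · refine ⟨⌊(p * (-Complex.I) ^ (K : ℕ)).re / δ⌋, ⌈(p * (-Complex.I) ^ (K : ℕ)).im / δ⌉,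
      Or.inr (Or.inr fun v hv => ?_)⟩
    have hch : ∀ w, dist w p < r → (w ∈ closure D.carrier ↔
        0 ≤ ((w - p) * (-Complex.I) ^ (K : ℕ)).im ∨ ((w - p) * (-Complex.I) ^ (K : ℕ)).re ≤ 0) :=
      fun w hw => by rw [hchart w hw, tp_csec_three]
    exact tp_lattice_reflex hδ hV K hch v (hin v hv)

/-- **Charts of lattice radius `N` at small mesh.** At mesh `δ` with `(2N + 2) δ ≤ r₀`, every
boundary vertex `u` of the lattice approximation (`u ∈ V`, `u + dir k ∉ V`) has a half-plane /
convex / reflex lattice chart on the box of sup-radius `N` (a frontier point lies within `2 δ` of the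
mesh point of `u`, and the box within `2N δ` of it). [folklore] -/
theorem bc_chart_of_small (D : JordanDomain) {δ : ℝ} (hδ : 0 < δ) {V : Finset (ℤ × ℤ)}
    (hV : ∀ v : ℤ × ℤ, v ∈ V ↔
      ((v.1 : ℂ) * ((δ : ℝ) : ℂ) + (v.2 : ℂ) * ((δ : ℝ) : ℂ) * Complex.I) ∈ closure D.carrier)
    (N : ℕ) {r₀ : ℝ} (hδr : (2 * N + 2) * δ ≤ r₀)
    (hunif : ∀ ζ ∈ frontier D.carrier, ∃ (p : ℂ) (r : ℝ) (K : Fin 4) (m : ℕ),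
      (m = 1 ∨ m = 2 ∨ m = 3) ∧ (∀ z, dist z ζ ≤ r₀ → dist z p < r) ∧
      ∀ z, dist z p < r → (z ∈ closure D.carrier ↔
        (m = 1 → 0 ≤ ((z - p) * (-Complex.I) ^ (K : ℕ)).re ∧
            0 ≤ ((z - p) * (-Complex.I) ^ (K : ℕ)).im) ∧
          (m = 2 → 0 ≤ ((z - p) * (-Complex.I) ^ (K : ℕ)).im) ∧
          (m = 3 → 0 ≤ ((z - p) * (-Complex.I) ^ (K : ℕ)).im ∨
            ((z - p) * (-Complex.I) ^ (K : ℕ)).re ≤ 0))) :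
    ∀ u ∈ V, ∀ k : Fin 4, u + dir k ∉ V → ∃ (K : Fin 4) (c₁ c₂ : ℤ),
      (∀ v : ℤ × ℤ, |v.1 - u.1| ≤ N → |v.2 - u.2| ≤ N →
        (v ∈ V ↔ c₂ ≤ v.1 * (dir (K + 1)).1 + v.2 * (dir (K + 1)).2)) ∨
      (∀ v : ℤ × ℤ, |v.1 - u.1| ≤ N → |v.2 - u.2| ≤ N →
        (v ∈ V ↔ c₁ ≤ v.1 * (dir K).1 + v.2 * (dir K).2 ∧
          c₂ ≤ v.1 * (dir (K + 1)).1 + v.2 * (dir (K + 1)).2)) ∨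
      (∀ v : ℤ × ℤ, |v.1 - u.1| ≤ N → |v.2 - u.2| ≤ N →
        (v ∈ V ↔ c₂ ≤ v.1 * (dir (K + 1)).1 + v.2 * (dir (K + 1)).2 ∨
          v.1 * (dir K).1 + v.2 * (dir K).2 ≤ c₁)) := by
  intro u hu k hk
  obtain ⟨ζ, hζ, hζu, -⟩ := ec_frontier_between D ((hV u).1 hu) (fun h => hk ((hV _).2 h))
  have h1 : dist ((u.1 : ℂ) * ((δ : ℝ) : ℂ) + (u.2 : ℂ) * ((δ : ℝ) : ℂ) * Complex.I)
      (((u + dir k).1 : ℂ) * ((δ : ℝ) : ℂ) + ((u + dir k).2 : ℂ) * ((δ : ℝ) : ℂ) * Complex.I) ≤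
      δ * 2 := by
    refine ec_mesh_dist_box hδ.le (N := 1) (by norm_num) (by norm_num) u (u + dir k) ?_ ?_
    · fin_cases k <;> simp [tp_dir_val]
    · fin_cases k <;> simp [tp_dir_val]
  have hN : (0 : ℝ) ≤ (N : ℝ) := Nat.cast_nonneg N
  have hbox : ∀ v : ℤ × ℤ, |v.1 - u.1| ≤ N → |v.2 - u.2| ≤ N →
      dist ((v.1 : ℂ) * ((δ : ℝ) : ℂ) + (v.2 : ℂ) * ((δ : ℝ) : ℂ) * Complex.I) ζ ≤
        (2 * N + 2) * δ := by
    intro v hv1 hv2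
    have h2 := ec_mesh_dist_box hδ.le (N := (N : ℤ)) (R' := 2 * N) (by positivity)
      (by push_cast; nlinarith) v u hv1 hv2
    have h3 := dist_triangle ((v.1 : ℂ) * ((δ : ℝ) : ℂ) + (v.2 : ℂ) * ((δ : ℝ) : ℂ) * Complex.I)
      ((u.1 : ℂ) * ((δ : ℝ) : ℂ) + (u.2 : ℂ) * ((δ : ℝ) : ℂ) * Complex.I) ζ
    have h4 := dist_comm ((u.1 : ℂ) * ((δ : ℝ) : ℂ) + (u.2 : ℂ) * ((δ : ℝ) : ℂ) * Complex.I) ζ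
    nlinarith
  obtain ⟨K, c₁, c₂, h⟩ := bc_lattice_chart D hδ hV hδr hunif hζ
  refine ⟨K, c₁, c₂, ?_⟩
  rcases h with h | h | h
  · exact Or.inl fun v hv1 hv2 => h v (hbox v hv1 hv2)
  · exact Or.inr (Or.inl fun v hv1 hv2 => h v (hbox v hv1 hv2))
  · exact Or.inr (Or.inr fun v hv1 hv2 => h v (hbox v hv1 hv2))

/-- **Charts of lattice radius `N`, eventually.** Along a mesh sequence `δ_n → 0⁺`, the lattice
approximations `V_n = {v : δ_n v ∈ closure D}` of a rectilinear Jordan domain eventually carry, at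
every boundary vertex, a half-plane / convex / reflex lattice chart on the box of sup-radius `N`,
for every fixed `N`. [folklore] -/
theorem bc_eventually_chart (D : JordanDomain)
    (hrect : ∃ S : Finset (ℂ × ℂ), (∀ q ∈ S, q.1.re = q.2.re ∨ q.1.im = q.2.im) ∧
      frontier D.carrier ⊆ ⋃ q ∈ S, segment ℝ q.1 q.2)
    (δ : ℕ → ℝ) (hδ : ∀ n, 0 < δ n) (hδ0 : Tendsto δ atTop (𝓝 0)) (V : ℕ → Finset (ℤ × ℤ))
    (hV : ∀ n, ∀ v : ℤ × ℤ, v ∈ V n ↔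
      ((v.1 : ℂ) * ((δ n : ℝ) : ℂ) + (v.2 : ℂ) * ((δ n : ℝ) : ℂ) * Complex.I) ∈ closure D.carrier)
    (N : ℕ) :
    ∀ᶠ n in atTop, ∀ u ∈ V n, ∀ k : Fin 4, u + dir k ∉ V n → ∃ (K : Fin 4) (c₁ c₂ : ℤ),
      (∀ v : ℤ × ℤ, |v.1 - u.1| ≤ N → |v.2 - u.2| ≤ N →
        (v ∈ V n ↔ c₂ ≤ v.1 * (dir (K + 1)).1 + v.2 * (dir (K + 1)).2)) ∨
      (∀ v : ℤ × ℤ, |v.1 - u.1| ≤ N → |v.2 - u.2| ≤ N →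
        (v ∈ V n ↔ c₁ ≤ v.1 * (dir K).1 + v.2 * (dir K).2 ∧
          c₂ ≤ v.1 * (dir (K + 1)).1 + v.2 * (dir (K + 1)).2)) ∨
      (∀ v : ℤ × ℤ, |v.1 - u.1| ≤ N → |v.2 - u.2| ≤ N →
        (v ∈ V n ↔ c₂ ≤ v.1 * (dir (K + 1)).1 + v.2 * (dir (K + 1)).2 ∨
          v.1 * (dir K).1 + v.2 * (dir K).2 ≤ c₁)) := by
  obtain ⟨r₀, hr₀, hunif⟩ := ec_uniform_closure_chart D hrect
  have hpos : (0 : ℝ) < 2 * N + 2 := by positivity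
  have hev : ∀ᶠ n in atTop, δ n < r₀ / (2 * N + 2) := hδ0 (Iio_mem_nhds (by positivity))
  filter_upwards [hev] with n hn
  refine bc_chart_of_small D (hδ n) (hV n) N (r₀ := r₀) ?_ hunif
  have := (lt_div_iff₀ hpos).1 hn
  linarith [mul_comm (δ n) (2 * N + 2)]

/-! ### Registered one-line form -/

/-- **Registered sub-goal `s17_configsNonempty_part2`** of `s17_eventually_configsNonempty`
(stmt-CriticalPhenomena-14132): along a mesh sequence the lattice approximations of a rectilinear
Jordan domain eventually carry, at every boundary vertex, a half-plane / convex / reflex lattice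
chart on the box of any fixed sup-radius `N` (one-line form of `bc_eventually_chart`). [folklore] -/
theorem s17_configsNonempty_part2 : ∀ (D : Literature.Probability.RandomPlanarGeometry.JordanDomain), (∃ S : Finset (ℂ × ℂ), (∀ q ∈ S, q.1.re = q.2.re ∨ q.1.im = q.2.im) ∧ frontier D.carrier ⊆ ⋃ q ∈ S, segment ℝ q.1 q.2) → ∀ (δ : ℕ → ℝ), (∀ n, 0 < δ n) → Filter.Tendsto δ Filter.atTop (nhds 0) → ∀ (V : ℕ → Finset (ℤ × ℤ)), (∀ n, ∀ v : ℤ × ℤ, v ∈ V n ↔ (((v).1 : ℂ) * ((δ n : ℝ) : ℂ) + ((v).2 : ℂ) * ((δ n : ℝ) : ℂ) * Complex.I) ∈ closure D.carrier) → ∀ (N : ℕ), ∀ᶠ n in Filter.atTop, ∀ u ∈ V n, ∀ k : Fin 4, u + Literature.Probability.LatticeModels.CollarLegModel.dir k ∉ V n → ∃ (K : Fin 4) (c₁ c₂ : ℤ), (∀ v : ℤ × ℤ, |v.1 - u.1| ≤ N → |v.2 - u.2| ≤ N → (v ∈ V n ↔ c₂ ≤ v.1 * (Literature.Probability.LatticeModels.CollarLegModel.dir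 (K + 1)).1 + v.2 * (Literature.Probability.LatticeModels.CollarLegModel.dir (K + 1)).2)) ∨ (∀ v : ℤ × ℤ, |v.1 - u.1| ≤ N → |v.2 - u.2| ≤ N → (v ∈ V n ↔ c₁ ≤ v.1 * (Literature.Probability.LatticeModels.CollarLegModel.dir K).1 + v.2 * (Literature.Probability.LatticeModels.CollarLegModel.dir K).2 ∧ c₂ ≤ v.1 * (Literature.Probability.LatticeModels.CollarLegModel.dir (K + 1)).1 + v.2 * (Literature.Probability.LatticeModels.CollarLegModel.dir (K + 1)).2)) ∨ (∀ v : ℤ × ℤ, |v.1 - u.1| ≤ N → |v.2 - u.2| ≤ N → (v ∈ V n ↔ c₂ ≤ v.1 * (Literature.Probability.LatticeModels.CollarLegModel.dir (K + 1)).1 + v.2 * (Literature.Probability.LatticeModels.CollarLegModel.dir (K + 1)).2 ∨ v.1 * (Literature.Probability.LatticeModels.CollarLegModel.dir K).1 + v.2 * (Literature.Probability.LatticeModels.CollarLegModel.dir K).2 ≤ c₁)) :=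
  fun D hD δ hδ hδ0 V hV N => bc_eventually_chart D hD δ hδ hδ0 V hV N

end Summit.CriticalPhenomena.CardyFormulaZ2.Cruxes.BoundaryDefectGaussianR.RainbowMonomialsInExcursionKernels

end
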